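import Summits.BirchSwinnertonDyer.BirchSwinnertonDyer.Theorems.UniversalToricDescentThinCombFrameUniqueness
import Summits.BirchSwinnertonDyer.BirchSwinnertonDyer.Theorems.UniversalToricDescentThinCombGridSupply
import Summits.BirchSwinnertonDyer.BirchSwinnertonDyer.Theorems.UniversalToricDescentThinCombValueLimits
import Literature.NumberTheory.EllipticCurves.HeegnerHypothesisKroneckerProofs
import HarnessLib

/-!
# SIZE RIGIDITY OF ♯♯-FRAMES: a non-zero ♯♯-frame with constants `(C, X, Y)` has `‖X·κ̂‖ = ‖Y‖`, `κ̂ = ι′⁻¹(N·|d_K|/4)` — the `3`-adic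
# SIZE of the second grading relative to the first is that of the functional-equation constant, for EVERY frame
# (helper on the rational wall `RationalSplitIMCInclusionAtThree`, stmt-BirchSwinnertonDyer-24207, line `ratwall_thin_comb` v10;
# cell `pub/bsd-wall`, LEAD `cruxlead-24207` g37; `--supports stmt-BirchSwinnertonDyer-24207`; nothing is closed; BSD is not proved)

WHY THIS FILE. The line's open stub (N♭) `NormalisedToricFrameUpToUnitAtThree` asks for a ♯♯-frame `L₂ ∈ R₀⟦T₁⟧⟦T₂⟧` of the toric
two-variable `3`-adic `L`-function of `f_E` with constants `(C, X, Y)`, `Y = X·κ̂·u`, `u ∈ ℤ₃ˣ` (`IsToricTwoVarLFunctionUpTo₂`). LEAD-CENSUS-g33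
§3b / g36 §2–§2b asked whether this NORMALISATION of the second grading is a restriction — could a frame exist with `Y/X` in another
class, so that a weaker ∃-statement would serve the line? The structure theory landed so far (`…GradingRenormalisation`: both gradings free
up to `ℤ₃ˣ`; `…FrameUniqueness`: frames with equal constants are equal; `…FrameReflection`: `φ_{A_τ}` maps `(C, X, Y)`-frames to
`(C, Y/κ̂, X·κ̂)`-frames) left open exactly the SIZE `‖Y/X‖`. This file settles it:

* §1 **`norm_mul_eq_norm_of_isToricTwoVarLFunctionUpTo₂`** — for every NON-ZERO ♯♯-frame `L₂` with constants `(C, X, Y)`, `X, Y ≠ 0`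
  (in a `𝔭`-adapted pair at the split `3`, `K` imaginary quadratic Heegner for `N`, conditional on Jacquet's cone fact BY NAME):
  `‖X·κ̂‖ = ‖Y‖`. PROOF. Put `λ₀ = X·κ̂/Y` and `G = φ_{A_τ}L₂`, a `(C, X·λ₀⁻¹, Y·λ₀)`-frame. On the grid supply (`…GridSupply`: types
  `(m(i+1), −m(j+1))`, points `(v₁^{j+1}u^{i+1} − 1, v₂^{j+1} − 1)`) the values satisfy `G(P_{ij})·λ₀^{m(i+1)} = λ₀^{m(j+1)}·L₂(P_{ij})`
  and both have norm `≤ 1` (`…ValueLimits.norm_le_one_of_hasValueAt₂`). If `‖λ₀‖ < 1` then `‖L₂(P_{ij})‖ ≤ θ^{i−j}`, `θ = ‖λ₀‖^m < 1`: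
  the values of `L₂` decay geometrically in `i` along every fibre `j`, so they all VANISH (decay lemma
  `…ValueLimits.eq_zero_of_hasValueAt₂_of_norm_le_geometric`: the fibre points accumulate at each other, `u^{3ⁿ} → 1`), and the fibred
  identity principle (`…ReflectionTransfer.unr_eq_zero_of_infinite_zeros₂_innerFibred`) gives `L₂ = 0`. If `‖λ₀‖ > 1` the same
  argument gives `G = 0`, i.e. `L₂ = 0` (`φ_A` is a ring automorphism). Hence `‖λ₀‖ = 1`.
* §2 `eq_zero_or_norm_mul_eq_norm` (the dichotomy form) and **`norm_div_eq_of_isToricTwoVarLFunctionUpTo₂`**: `‖Y/X‖ = ‖κ̂‖` for every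
  non-zero frame — the `ℤ₃ˣ`-freedom of (N♭) (`Y = X·κ̂·u`) exhausts the possible SIZES of the second grading: a typed interpolation formula
  at the additive split `3` must carry a `b`-grading of `3`-adic size exactly `‖κ̂‖ = |N·|d_K|/4|₃ = 3^{−v₃(N)}` (the supercuspidal
  `ε`-factor size `3^{c·b}` of Hida 1988 Lemma 5.2 (ii) / Hao–Loeffler 2025 Thm. 3.5 is FORCED, not chosen) — LEAD-CENSUS-g36 §2b's
  heuristic «`v₃(Y/X) = v₃(N)` is the only consistent class», as a theorem for its size part. What is NOT proved here: that `λ₀` is a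
  UNIT OF `ℤ₃` (the residual «multiplicative rigidity», an argument about `3`-adic exponentials); (N♭) itself; anything about existence.

HONEST SCOPE: statements about the interpolation predicate, conditional on the named print fact `jacquet1972_functionalEquation_rankinSelbergHecke_cone`;
nothing here is evidence that a frame exists at an additive split `3`; BSD is proved for no curve; 24207 / 20395 / 20186 / 32493 OPEN.

References: [cite: HaoLoeffler2025, Thm. 3.5 and remark (arXiv:2405.12611; the prefactor `(p^{t+1}/α)^b`, uniqueness by density)]
[cite: Hida1988AIF, §5 Lemma 5.2 (ii) (doi:10.5802/aif.1141)] [cite: CastellaWan2023, §2.4 Thm. 2.11 (arXiv:1607.02019)]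
[cite: Gouvea1993PadicNumbers, §5.6 Cor. 5.6.3–5.6.4] [cite: Jacquet1972, §19 Cor. 19.15] [cite: BuyukbodukLei2017, Def. 3.8 (arXiv:1707.00557)]
-/

set_option linter.dupNamespace false
set_option autoImplicit false

noncomputable section

open scoped Classical MatrixGroups
open Filter Topology

namespace Summit.BirchSwinnertonDyer.BirchSwinnertonDyer.Theorems.UniversalToricDescentThinComb.SizeRigidity

open NumberField IsDedekindDomain Field
open Literature.NumberTheory.EllipticCurves Literature.NumberTheory.GaloisRepresentations
open Summit.BirchSwinnertonDyer.Rank1Residual.X11b.Halves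
open Summit.BirchSwinnertonDyer.BirchSwinnertonDyer.Theorems.UniversalToricDescentThinComb

variable {K : Type} [Field K] [NumberField K]

/-! ### §1. Size rigidity -/

/-- **SIZE RIGIDITY OF ♯♯-FRAMES.** `K` imaginary quadratic Heegner for `N`, `3 = 𝔭𝔭′` with `𝔭` of degree one induced by `ι′`,
`(κ₁, κ₂; γ₁, γ₂)` a generator pair with `κ₁` unramified outside `𝔭`, `f = Dt.f`; Jacquet's cone fact BY NAME. If `L₂ ≠ 0` is a ♯♯-frame
with constants `(C, X, Y)`, `X, Y ≠ 0`, then `‖X·κ̂‖ = ‖Y‖` for `κ̂ = ι′⁻¹(N·|d_K|/4)`: the reflected frame `φ_{A_τ}L₂` has the values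
`λ₀^{b−a}·L₂(P)` (`λ₀ = Xκ̂/Y`) on the grid supply, both families of values are integral, and geometric decay along the accumulating fibres
would kill `L₂` (`‖λ₀‖ < 1`) or `φ_{A_τ}L₂` (`‖λ₀‖ > 1`). [cite: HaoLoeffler2025, Thm. 3.5, remark (arXiv:2405.12611)]
[cite: Gouvea1993PadicNumbers, §5.6 Cor. 5.6.3–5.6.4] [cite: Jacquet1972, §19 Cor. 19.15] -/
theorem norm_mul_eq_norm_of_isToricTwoVarLFunctionUpTo₂ (hJ : jacquet1972_functionalEquation_rankinSelbergHecke_cone)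
    (hK : IsImaginaryQuadratic K) {N : ℕ} [NeZero N] (W : WeierstrassCurve ℚ)
    (Dt : Literature.NumberTheory.EllipticCurves.ModularForms.ModularParametrizationData W N)
    (hH : SatisfiesHeegnerHypothesis N K)
    {𝔭 : HeightOneSpectrum (𝓞 K)} (h3 : ((3 : ℕ) : 𝓞 K) ∈ 𝔭.asIdeal)
    {𝔭' : HeightOneSpectrum (𝓞 K)} (h3' : ((3 : ℕ) : 𝓞 K) ∈ 𝔭'.asIdeal) (hne : 𝔭' ≠ 𝔭)
    (ι' : PadicAlgCl 3 ≃+* ℂ) (hι : Summit.BirchSwinnertonDyer.BirchSwinnertonDyer.Theorems.SchneiderFree.BranchInducesPrime 3 ι' 𝔭)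
    {κ₁ κ₂ : ZpExtension K 3} {γ₁ γ₂ : absoluteGaloisGroup K} (hpair : ZpExtension.IsTopGeneratorPair κ₁ κ₂ γ₁ γ₂)
    (hur₁ : ∀ v : HeightOneSpectrum (𝓞 K), v ≠ 𝔭 → ∀ 𝔓 ∈ v.primesAbove,
      𝔓.inertia (absoluteGaloisGroup K) ≤ κ₁.kerSubgroup)
    {ΩK : ℂ} {C X Y : ℂ_[3]} {L₂ : PowerSeries (UnrSeries 3)} (hX : X ≠ 0) (hY : Y ≠ 0)
    (hL : IsToricTwoVarLFunctionUpTo₂ C X Y ι' 𝔭 𝔭' κ₁ κ₂ γ₁ γ₂ Dt.f ΩK L₂) (hL0 : L₂ ≠ 0) :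
    ‖X * (((ι'.symm ((N : ℂ) * ((NumberField.discr K).natAbs : ℂ) / 4) : PadicAlgCl 3)) : ℂ_[3])‖ = ‖Y‖ := by
  letI : Algebra ℤ_[3] (unrIntegers 3) := (toUnr 3).toAlgebra
  -- the frame involution `A = A_τ` and the reflected frame `G = φ_A L₂`
  obtain ⟨c, hc⟩ := FrameInvolution.exists_not_mem_range_absGaloisRestrict_rat hK
  obtain ⟨τ, hτ⟩ := FrameInvolution.exists_conjInv hK.1 c
  obtain ⟨A, hA, -⟩ := FrameInvolution.exists_GL_eq_frameMatrixOf_of_conjInv hK hpair hτ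
  have hG := FrameReflection.isToricTwoVarLFunctionUpTo₂_frameSubst_involution hJ hK Dt.f Dt.isNewformOf.1 hH h3 h3' hne ι'
    hpair hc hτ A hA hL
  set G : PowerSeries (UnrSeries 3) := IwasawaAlgebra₂.frameSubst (unrIntegers 3) A L₂ with hGdef
  have hG0 : G ≠ 0 := fun h ↦ hL0 ((RingEquiv.map_eq_zero_iff _).mp h)
  set κh : ℂ_[3] := (((ι'.symm ((N : ℂ) * ((NumberField.discr K).natAbs : ℂ) / 4) : PadicAlgCl 3)) : ℂ_[3]) with hκh
  have hκh0 : κh ≠ 0 := by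
    have hκc0 : ((N : ℂ) * ((NumberField.discr K).natAbs : ℂ) / 4) ≠ 0 := by
      refine div_ne_zero (mul_ne_zero (by exact_mod_cast NeZero.ne N) ?_) (by norm_num)
      exact_mod_cast Int.natAbs_ne_zero.mpr (NumberField.discr_ne_zero K)
    rw [hκh, PadicComplex.coe_eq]
    exact (map_ne_zero_iff _ (algebraMap (PadicAlgCl 3) ℂ_[3]).injective).mpr ((map_ne_zero_iff _ ι'.symm.injective).mpr hκc0)
  set lam : ℂ_[3] := X * κh * Y⁻¹ with hlam
  have hlam0 : lam ≠ 0 := mul_ne_zero (mul_ne_zero hX hκh0) (inv_ne_zero hY)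
  have hlam_pos : 0 < ‖lam‖ := norm_pos_iff.mpr hlam0
  -- the grid supply
  obtain ⟨u, v₁, v₂, m, hm, hu, hv₁, hv₂, hut, hv₂t, grid⟩ :=
    GridSupply.gridSupply hJ (by norm_num) hK W Dt hH h3 h3' hne ι' hι hpair hur₁ hc hτ
  choose ψ r Lc hinf hunr hr hrκ hLd hLe hx hy using grid
  have h31 : ‖((3 : ℕ) : ℂ_[3])‖ < 1 := norm_prime_padicComplex_lt_one
  have h30 : ((3 : ℕ) : ℂ_[3]) ≠ 0 := by exact_mod_cast (show (3 : ℕ) ≠ 0 by norm_num)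
  have hu1 : ‖u - 1‖ ≤ 1 := (hu.trans h31).le
  have hv₁1 : ‖v₁ - 1‖ ≤ 1 := (hv₁.trans h31).le
  have hv₂1 : ‖v₂ - 1‖ ≤ 1 := (hv₂.trans h31).le
  have hu_ne : u ≠ 0 := fun h ↦ by rw [h, zero_sub, norm_neg, norm_one] at hu; exact (lt_irrefl _) (hu.trans h31)
  have hv₁_ne : v₁ ≠ 0 := fun h ↦ by rw [h, zero_sub, norm_neg, norm_one] at hv₁; exact (lt_irrefl _) (hv₁.trans h31)
  have hv₂_ne : v₂ ≠ 0 := fun h ↦ by rw [h, zero_sub, norm_neg, norm_one] at hv₂; exact (lt_irrefl _) (hv₂.trans h31)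
  -- one-units: the fibre base `v₁^{j+1}` and the inner values `v₂^{j+1} − 1`
  have hv₁pow : ∀ j : ℕ, ‖v₁ ^ (j + 1) - 1‖ < ‖((3 : ℕ) : ℂ_[3])‖ := fun j ↦
    (RamifiedSevenEllipticUnits.LemmaXi.norm_pow_sub_one_le hv₁1 _).trans_lt hv₁
  have hv₂pow : ∀ j : ℕ, ‖v₂ ^ (j + 1) - 1‖ ≤ ‖((3 : ℕ) : ℂ_[3])‖ := fun j ↦
    ((RamifiedSevenEllipticUnits.LemmaXi.norm_pow_sub_one_le hv₂1 _).trans_lt hv₂).le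
  have hv₁n : ‖v₁‖ ≤ 1 := RamifiedSevenEllipticUnits.LemmaXi.norm_le_one_of_norm_sub_one_le_one hv₁1
  have hpt : ∀ i j : ℕ, ‖v₁ ^ (j + 1) * u ^ (i + 1) - 1‖ ≤ ‖((3 : ℕ) : ℂ_[3])‖ := fun i j ↦
    (FibredSupply.norm_mul_sub_one_lt (by rw [norm_pow]; exact pow_le_one₀ (norm_nonneg _) hv₁n) (hv₁pow j)
      ((RamifiedSevenEllipticUnits.LemmaXi.norm_pow_sub_one_le hu1 _).trans_lt hu)).le
  have hinjD : Function.Injective fun j : ℕ ↦ v₂ ^ (j + 1) - 1 := by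
    simpa only [one_mul] using FibredSupply.injective_mul_pow_sub_one one_ne_zero hv₂_ne hv₂t
  have hinjF : ∀ j : ℕ, Function.Injective fun i : ℕ ↦ v₁ ^ (j + 1) * u ^ (i + 1) - 1 := fun j ↦
    FibredSupply.injective_mul_pow_sub_one (pow_ne_zero _ hv₁_ne) hu_ne hut
  -- the display values `D i j` and the two value families `VL` (of `L₂`) and `VG` (of `G`) on the grid
  obtain ⟨D, hD⟩ : ∃ D : ℕ → ℕ → ℂ_[3], ∀ i j, D i j =
      (((ι'.symm (toricInterpolationValue 3 Dt.f 𝔭 𝔭' (ψ i j) (m * (i + 1)) (m * (j + 1)) ΩK (Lc i j 1))) : PadicAlgCl 3) :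
        ℂ_[3]) := ⟨_, fun _ _ ↦ rfl⟩
  obtain ⟨VL, hVL⟩ : ∃ VL : ℕ → ℕ → ℂ_[3], ∀ i j, VL i j = C * X ^ (m * (i + 1)) * Y ^ (m * (j + 1)) * D i j :=
    ⟨_, fun _ _ ↦ rfl⟩
  obtain ⟨VG, hVG⟩ : ∃ VG : ℕ → ℕ → ℂ_[3], ∀ i j,
      VG i j = C * (Y * κh⁻¹) ^ (m * (i + 1)) * (X * κh) ^ (m * (j + 1)) * D i j := ⟨_, fun _ _ ↦ rfl⟩
  have ha : ∀ i : ℕ, 1 ≤ m * (i + 1) := fun i ↦ Nat.mul_pos hm (Nat.succ_pos i)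
  have hvalL : ∀ i j, UnrSeries.HasValueAt₂ L₂ (v₁ ^ (j + 1) * u ^ (i + 1) - 1) (v₂ ^ (j + 1) - 1) (VL i j) := by
    intro i j
    have h := hL (ψ i j) _ _ (ha i) (ha j) (hinf i j) (hunr i j) (r i j) (hr i j) (hrκ i j) (Lc i j) (hLd i j) (hLe i j)
    rw [hx i j, hy i j, ← hD] at h
    rwa [hVL]
  have hvalG : ∀ i j, UnrSeries.HasValueAt₂ G (v₁ ^ (j + 1) * u ^ (i + 1) - 1) (v₂ ^ (j + 1) - 1) (VG i j) := by
    intro i j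
    have h := hG (ψ i j) _ _ (ha i) (ha j) (hinf i j) (hunr i j) (r i j) (hr i j) (hrκ i j) (Lc i j) (hLd i j) (hLe i j)
    rw [hx i j, hy i j, ← hD] at h
    rwa [hVG]
  -- integrality of both value families
  have hnL : ∀ i j, ‖VL i j‖ ≤ 1 := fun i j ↦
    ValueLimits.norm_le_one_of_hasValueAt₂ (hvalL i j) ((hpt i j).trans h31.le) ((hv₂pow j).trans h31.le)
  have hnG : ∀ i j, ‖VG i j‖ ≤ 1 := fun i j ↦
    ValueLimits.norm_le_one_of_hasValueAt₂ (hvalG i j) ((hpt i j).trans h31.le) ((hv₂pow j).trans h31.le)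
  -- the reflected values differ by `λ₀^{m(j+1)} / λ₀^{m(i+1)}`
  set θ : ℝ := ‖lam‖ ^ m with hθ
  have hθpos : 0 < θ := pow_pos hlam_pos m
  have hrel : ∀ i j, ‖VG i j‖ * θ ^ (i + 1) = θ ^ (j + 1) * ‖VL i j‖ := by
    intro i j
    have e1 : Y * κh⁻¹ * lam = X := by
      rw [hlam]
      calc Y * κh⁻¹ * (X * κh * Y⁻¹) = X * (κh⁻¹ * κh) * (Y * Y⁻¹) := by ring
        _ = X := by rw [inv_mul_cancel₀ hκh0, mul_inv_cancel₀ hY, mul_one, mul_one]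
    have e2 : lam * Y = X * κh := by
      rw [hlam]
      calc X * κh * Y⁻¹ * Y = X * κh * (Y⁻¹ * Y) := by ring
        _ = X * κh := by rw [inv_mul_cancel₀ hY, mul_one]
    have hC3 : VG i j * lam ^ (m * (i + 1)) = lam ^ (m * (j + 1)) * VL i j := by
      calc VG i j * lam ^ (m * (i + 1))
          = C * (Y * κh⁻¹ * lam) ^ (m * (i + 1)) * (X * κh) ^ (m * (j + 1)) * D i j := by rw [hVG, mul_pow]; ring
        _ = C * X ^ (m * (i + 1)) * (lam * Y) ^ (m * (j + 1)) * D i j := by rw [e1, e2]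
        _ = lam ^ (m * (j + 1)) * VL i j := by rw [hVL, mul_pow]; ring
    have h := congrArg (‖·‖) hC3
    simp only [norm_mul, norm_pow] at h
    rw [hθ, ← pow_mul, ← pow_mul]
    exact h
  rcases lt_trichotomy ‖lam‖ 1 with hlt | heq | hgt
  · -- `‖λ₀‖ < 1`: the values of `L₂` decay geometrically along every fibre, so `L₂ = 0`
    exfalso
    have hθ1 : θ < 1 := pow_lt_one₀ hlam_pos.le hlt hm.ne'
    apply hL0
    refine ReflectionTransfer.unr_eq_zero_of_infinite_zeros₂_innerFibred h30 h31 (Set.infinite_range_of_injective hinjD) ?_ ?_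
    · rintro y ⟨j, rfl⟩; exact hv₂pow j
    · rintro y ⟨j, rfl⟩
      refine Set.infinite_of_injective_forall_mem (hinjF j) fun i ↦ ⟨hpt i j, ?_⟩
      have hdec : ∀ i, ‖VL i j‖ ≤ θ⁻¹ ^ (j + 1) * θ ^ (i + 1) := by
        intro i
        have h1 : θ ^ (j + 1) * ‖VL i j‖ ≤ θ ^ (i + 1) := by
          rw [← hrel]; exact mul_le_of_le_one_left (pow_nonneg hθpos.le _) (hnG i j)
        rw [inv_pow, ← div_eq_inv_mul, le_div_iff₀ (pow_pos hθpos _), mul_comm]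
        exact h1
      have hz := ValueLimits.eq_zero_of_hasValueAt₂_of_norm_le_geometric hu (hv₁pow j) (hv₂pow j)
        (fun i ↦ hvalL i j) (pow_nonneg (inv_nonneg.mpr hθpos.le) _) hθpos.le hθ1 hdec i
      have hv := hvalL i j
      rwa [hz] at hv
  · -- `‖λ₀‖ = 1`
    have h1 : X * κh = Y * lam := by rw [hlam, mul_comm Y _, mul_assoc, inv_mul_cancel₀ hY, mul_one]
    rw [h1, norm_mul, heq, mul_one]
  · -- `‖λ₀‖ > 1`: the values of `G = φ_A L₂` decay geometrically along every fibre, so `G = 0`, i.e. `L₂ = 0`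
    exfalso
    have hθ1 : 1 < θ := one_lt_pow₀ hgt hm.ne'
    have hθi0 : 0 ≤ θ⁻¹ := inv_nonneg.mpr hθpos.le
    have hθi1 : θ⁻¹ < 1 := inv_lt_one_of_one_lt₀ hθ1
    apply hG0
    refine ReflectionTransfer.unr_eq_zero_of_infinite_zeros₂_innerFibred h30 h31 (Set.infinite_range_of_injective hinjD) ?_ ?_
    · rintro y ⟨j, rfl⟩; exact hv₂pow j
    · rintro y ⟨j, rfl⟩
      refine Set.infinite_of_injective_forall_mem (hinjF j) fun i ↦ ⟨hpt i j, ?_⟩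
      have hdec : ∀ i, ‖VG i j‖ ≤ θ ^ (j + 1) * θ⁻¹ ^ (i + 1) := by
        intro i
        have h1 : ‖VG i j‖ * θ ^ (i + 1) ≤ θ ^ (j + 1) := by
          rw [hrel]; exact mul_le_of_le_one_right (pow_nonneg hθpos.le _) (hnL i j)
        rw [inv_pow, ← div_eq_mul_inv, le_div_iff₀ (pow_pos hθpos _)]
        exact h1
      have hz := ValueLimits.eq_zero_of_hasValueAt₂_of_norm_le_geometric hu (hv₁pow j) (hv₂pow j)
        (fun i ↦ hvalG i j) (pow_nonneg hθpos.le _) hθi0 hθi1 hdec i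
      have hv := hvalG i j
      rwa [hz] at hv

/-! ### §2. Corollaries: the dichotomy, the size of the grading ratio, the unit-norm normalisation -/

/-- **Dichotomy form**: every ♯♯-frame with `X, Y ≠ 0` is ZERO or has `‖X·κ̂‖ = ‖Y‖`. [cite: HaoLoeffler2025, Thm. 3.5 (arXiv:2405.12611)] -/
theorem eq_zero_or_norm_mul_eq_norm (hJ : jacquet1972_functionalEquation_rankinSelbergHecke_cone)
    (hK : IsImaginaryQuadratic K) {N : ℕ} [NeZero N] (W : WeierstrassCurve ℚ)
    (Dt : Literature.NumberTheory.EllipticCurves.ModularForms.ModularParametrizationData W N)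
    (hH : SatisfiesHeegnerHypothesis N K)
    {𝔭 : HeightOneSpectrum (𝓞 K)} (h3 : ((3 : ℕ) : 𝓞 K) ∈ 𝔭.asIdeal)
    {𝔭' : HeightOneSpectrum (𝓞 K)} (h3' : ((3 : ℕ) : 𝓞 K) ∈ 𝔭'.asIdeal) (hne : 𝔭' ≠ 𝔭)
    (ι' : PadicAlgCl 3 ≃+* ℂ) (hι : Summit.BirchSwinnertonDyer.BirchSwinnertonDyer.Theorems.SchneiderFree.BranchInducesPrime 3 ι' 𝔭)
    {κ₁ κ₂ : ZpExtension K 3} {γ₁ γ₂ : absoluteGaloisGroup K} (hpair : ZpExtension.IsTopGeneratorPair κ₁ κ₂ γ₁ γ₂)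
    (hur₁ : ∀ v : HeightOneSpectrum (𝓞 K), v ≠ 𝔭 → ∀ 𝔓 ∈ v.primesAbove,
      𝔓.inertia (absoluteGaloisGroup K) ≤ κ₁.kerSubgroup)
    {ΩK : ℂ} {C X Y : ℂ_[3]} {L₂ : PowerSeries (UnrSeries 3)} (hX : X ≠ 0) (hY : Y ≠ 0)
    (hL : IsToricTwoVarLFunctionUpTo₂ C X Y ι' 𝔭 𝔭' κ₁ κ₂ γ₁ γ₂ Dt.f ΩK L₂) :
    L₂ = 0 ∨ ‖X * (((ι'.symm ((N : ℂ) * ((NumberField.discr K).natAbs : ℂ) / 4) : PadicAlgCl 3)) : ℂ_[3])‖ = ‖Y‖ :=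
  or_iff_not_imp_left.mpr fun hL0 ↦
    norm_mul_eq_norm_of_isToricTwoVarLFunctionUpTo₂ hJ hK W Dt hH h3 h3' hne ι' hι hpair hur₁ hX hY hL hL0

/-- **THE SIZE OF THE GRADING RATIO IS FORCED**: for every non-zero ♯♯-frame, `‖Y/X‖ = ‖κ̂‖ = |N·|d_K|/4|₃` — the second grading carries
exactly the `3`-adic size of the supercuspidal local `ε`-factor (Hida 1988 Lemma 5.2 (ii): the prefactor `3^{c·b}`; Hao–Loeffler 2025
Thm. 3.5: `(p^{t+1}/α)^b`), for EVERY frame and not only for the normalised ones of (N♭). [cite: Hida1988AIF, §5 Lemma 5.2 (ii)]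
[cite: HaoLoeffler2025, Thm. 3.5 (arXiv:2405.12611)] -/
theorem norm_div_eq_of_isToricTwoVarLFunctionUpTo₂ (hJ : jacquet1972_functionalEquation_rankinSelbergHecke_cone)
    (hK : IsImaginaryQuadratic K) {N : ℕ} [NeZero N] (W : WeierstrassCurve ℚ)
    (Dt : Literature.NumberTheory.EllipticCurves.ModularForms.ModularParametrizationData W N)
    (hH : SatisfiesHeegnerHypothesis N K)
    {𝔭 : HeightOneSpectrum (𝓞 K)} (h3 : ((3 : ℕ) : 𝓞 K) ∈ 𝔭.asIdeal)
    {𝔭' : HeightOneSpectrum (𝓞 K)} (h3' : ((3 : ℕ) : 𝓞 K) ∈ 𝔭'.asIdeal) (hne : 𝔭' ≠ 𝔭)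
    (ι' : PadicAlgCl 3 ≃+* ℂ) (hι : Summit.BirchSwinnertonDyer.BirchSwinnertonDyer.Theorems.SchneiderFree.BranchInducesPrime 3 ι' 𝔭)
    {κ₁ κ₂ : ZpExtension K 3} {γ₁ γ₂ : absoluteGaloisGroup K} (hpair : ZpExtension.IsTopGeneratorPair κ₁ κ₂ γ₁ γ₂)
    (hur₁ : ∀ v : HeightOneSpectrum (𝓞 K), v ≠ 𝔭 → ∀ 𝔓 ∈ v.primesAbove,
      𝔓.inertia (absoluteGaloisGroup K) ≤ κ₁.kerSubgroup)
    {ΩK : ℂ} {C X Y : ℂ_[3]} {L₂ : PowerSeries (UnrSeries 3)} (hX : X ≠ 0) (hY : Y ≠ 0)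
    (hL : IsToricTwoVarLFunctionUpTo₂ C X Y ι' 𝔭 𝔭' κ₁ κ₂ γ₁ γ₂ Dt.f ΩK L₂) (hL0 : L₂ ≠ 0) :
    ‖Y / X‖ = ‖(((ι'.symm ((N : ℂ) * ((NumberField.discr K).natAbs : ℂ) / 4) : PadicAlgCl 3)) : ℂ_[3])‖ := by
  have h := norm_mul_eq_norm_of_isToricTwoVarLFunctionUpTo₂ hJ hK W Dt hH h3 h3' hne ι' hι hpair hur₁ hX hY hL hL0
  rw [norm_div, div_eq_iff (norm_pos_iff.mpr hX).ne', mul_comm, ← norm_mul]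
  exact h.symm

/-- **Unit-norm normalisation of every non-zero frame**: `Y = X·κ̂·μ` for some `μ ∈ ℂ₃` with `‖μ‖ = 1`. Compare (N♭)
(`…NormalisedToricFrameDefs.NormalisedToricFrameUpToUnitAtThree`): `Y = X·κ̂·u` with `u` a UNIT OF `ℤ₃` — the gap between «some frame
exists» and (N♭) is exactly «`μ` of norm one» versus «`μ ∈ ℤ₃ˣ`» (the residual multiplicative rigidity), the SIZE being forced.
[cite: Hida1988AIF, §5 Lemma 5.2 (ii)] [cite: HaoLoeffler2025, Thm. 3.5 (arXiv:2405.12611)] -/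
theorem exists_norm_eq_one_mul_eq_of_isToricTwoVarLFunctionUpTo₂ (hJ : jacquet1972_functionalEquation_rankinSelbergHecke_cone)
    (hK : IsImaginaryQuadratic K) {N : ℕ} [NeZero N] (W : WeierstrassCurve ℚ)
    (Dt : Literature.NumberTheory.EllipticCurves.ModularForms.ModularParametrizationData W N)
    (hH : SatisfiesHeegnerHypothesis N K)
    {𝔭 : HeightOneSpectrum (𝓞 K)} (h3 : ((3 : ℕ) : 𝓞 K) ∈ 𝔭.asIdeal)
    {𝔭' : HeightOneSpectrum (𝓞 K)} (h3' : ((3 : ℕ) : 𝓞 K) ∈ 𝔭'.asIdeal) (hne : 𝔭' ≠ 𝔭)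
    (ι' : PadicAlgCl 3 ≃+* ℂ) (hι : Summit.BirchSwinnertonDyer.BirchSwinnertonDyer.Theorems.SchneiderFree.BranchInducesPrime 3 ι' 𝔭)
    {κ₁ κ₂ : ZpExtension K 3} {γ₁ γ₂ : absoluteGaloisGroup K} (hpair : ZpExtension.IsTopGeneratorPair κ₁ κ₂ γ₁ γ₂)
    (hur₁ : ∀ v : HeightOneSpectrum (𝓞 K), v ≠ 𝔭 → ∀ 𝔓 ∈ v.primesAbove,
      𝔓.inertia (absoluteGaloisGroup K) ≤ κ₁.kerSubgroup)
    {ΩK : ℂ} {C X Y : ℂ_[3]} {L₂ : PowerSeries (UnrSeries 3)} (hX : X ≠ 0) (hY : Y ≠ 0)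
    (hL : IsToricTwoVarLFunctionUpTo₂ C X Y ι' 𝔭 𝔭' κ₁ κ₂ γ₁ γ₂ Dt.f ΩK L₂) (hL0 : L₂ ≠ 0) :
    ∃ μ : ℂ_[3], ‖μ‖ = 1 ∧
      Y = X * (((ι'.symm ((N : ℂ) * ((NumberField.discr K).natAbs : ℂ) / 4) : PadicAlgCl 3)) : ℂ_[3]) * μ := by
  have h := norm_mul_eq_norm_of_isToricTwoVarLFunctionUpTo₂ hJ hK W Dt hH h3 h3' hne ι' hι hpair hur₁ hX hY hL hL0
  set κh : ℂ_[3] := (((ι'.symm ((N : ℂ) * ((NumberField.discr K).natAbs : ℂ) / 4) : PadicAlgCl 3)) : ℂ_[3]) with hκh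
  have hXκ : X * κh ≠ 0 := by
    intro h0; rw [h0, norm_zero] at h; exact hY (norm_eq_zero.mp h.symm)
  refine ⟨Y / (X * κh), ?_, ?_⟩
  · rw [norm_div, ← h, div_self (norm_ne_zero_iff.mpr hXκ)]
  · rw [mul_div_cancel₀ _ hXκ]

/-! ### §3. The zero frame (the degenerate branch of «some frame exists») -/

/-- The zero series has the value `0` everywhere. [cite: CastellaWan2023, §2.4 (arXiv:1607.02019)] -/
theorem hasValueAt₂_zero {p : ℕ} [Fact p.Prime] (x y : ℂ_[p]) :
    UnrSeries.HasValueAt₂ (0 : PowerSeries (UnrSeries p)) x y 0 := by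
  unfold UnrSeries.HasValueAt₂
  simp

/-- **The zero frame is a frame for ALL constants.** If `0` is a ♯♯-frame with constants `(C, X, Y)`, `C, X, Y ≠ 0`, then every
interpolated display value vanishes, so `0` is a ♯♯-frame with ANY constants `(C′, X′, Y′)` — in particular with the normalised ones of
(N♭). Together with §1: «some ♯♯-frame with `X, Y ≠ 0` exists» implies «a frame with `‖Y/X‖ = ‖κ̂‖` exists» (the zero frame, or the given
one). [cite: CastellaWan2023, §2.4 Thm. 2.11 (arXiv:1607.02019)] -/
theorem isToricTwoVarLFunctionUpTo₂_zero_of_zero {p : ℕ} [Fact p.Prime] {N : ℕ} {ι : PadicAlgCl p ≃+* ℂ}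
    {𝔭 𝔭' : HeightOneSpectrum (𝓞 K)} {κ₁ κ₂ : ZpExtension K p} {γ₁ γ₂ : absoluteGaloisGroup K}
    {f : CuspForm (CongruenceSubgroup.Gamma0 N) 2} {ΩK : ℂ} {C X Y : ℂ_[p]} (hC : C ≠ 0) (hX : X ≠ 0) (hY : Y ≠ 0)
    (h : IsToricTwoVarLFunctionUpTo₂ C X Y ι 𝔭 𝔭' κ₁ κ₂ γ₁ γ₂ f ΩK 0) (C' X' Y' : ℂ_[p]) :
    IsToricTwoVarLFunctionUpTo₂ C' X' Y' ι 𝔭 𝔭' κ₁ κ₂ γ₁ γ₂ f ΩK 0 := by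
  intro ψ a b ha hb hinf hunr r hr hκ L hLd hLe
  have hv := h ψ a b ha hb hinf hunr r hr hκ L hLd hLe
  have h0 := (hasValueAt₂_zero (p := p) (avatarValueAt r γ₁ - 1) (avatarValueAt r γ₂ - 1)).unique hv
  have hD : (((ι.symm (toricInterpolationValue p f 𝔭 𝔭' ψ a b ΩK (L 1))) : PadicAlgCl p) : ℂ_[p]) = 0 := by
    rcases mul_eq_zero.mp h0.symm with h1 | h1
    · exact absurd h1 (mul_ne_zero (mul_ne_zero hC (pow_ne_zero _ hX)) (pow_ne_zero _ hY))
    · exact h1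
  rw [hD, mul_zero]
  exact hasValueAt₂_zero _ _

/-! ### §4. The size in terms of the level: `‖Y/X‖ = |N|₃`, i.e. `v₃(Y/X) = v₃(N)` (appended 2026-08-30, LEAD `cruxlead-24207` g37) -/

/-- **`‖κ̂‖ = |N|₃`.** Under the Heegner hypothesis for `(N, K)` with `3 ∣ N` (`K` quadratic): `3 ∤ d_K` (split primes are unramified,
`Literature.SatisfiesHeegnerHypothesis.not_dvd_discr`) and `3 ∤ 4`, so `‖ι′⁻¹(N·|d_K|/4)‖ = ‖N‖` in `ℂ₃` (`ι′⁻¹` fixes rationals).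
[cite: GrossZagier1986, I.(3.1) (the standing `(D, N) = 1`)] -/
theorem norm_kappaHat_eq_norm_level (hK2 : Module.finrank ℚ K = 2) {N : ℕ} (hH : SatisfiesHeegnerHypothesis N K) (h3N : 3 ∣ N)
    (ι' : PadicAlgCl 3 ≃+* ℂ) :
    ‖(((ι'.symm ((N : ℂ) * ((NumberField.discr K).natAbs : ℂ) / 4) : PadicAlgCl 3)) : ℂ_[3])‖ = ‖((N : ℕ) : ℂ_[3])‖ := by
  have hd : ¬ 3 ∣ (NumberField.discr K).natAbs := fun h ↦
    Literature.SatisfiesHeegnerHypothesis.not_dvd_discr hK2 hH Nat.prime_three h3N (Int.natCast_dvd.mpr h)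
  have h4 : ‖(4 : PadicAlgCl 3)‖ = 1 := by
    have h := PadicAlgCl.norm_natCast_eq_one_of_not_dvd (ℓ := 3) (m := 4) (by norm_num)
    simpa using h
  have hmap : ι'.symm ((N : ℂ) * ((NumberField.discr K).natAbs : ℂ) / 4) =
      (N : PadicAlgCl 3) * (((NumberField.discr K).natAbs : ℕ) : PadicAlgCl 3) / 4 := by
    rw [map_div₀, map_mul, map_natCast, map_natCast, map_ofNat]
  rw [PadicComplex.norm_extends, hmap, norm_div, norm_mul, PadicAlgCl.norm_natCast_eq_one_of_not_dvd hd, h4, mul_one, div_one,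
    ← PadicComplex.coe_natCast, PadicComplex.norm_extends]

/-- **`v₃(Y/X) = v₃(N)` FOR EVERY NON-ZERO ♯♯-FRAME** (LEAD-CENSUS-g36 §2b as a theorem, size part): in the setting of §1 with `3 ∣ N`
(the additive prime), a non-zero ♯♯-frame with constants `(C, X, Y)`, `X, Y ≠ 0`, has `‖Y/X‖ = ‖N‖₃ = 3^{−v₃(N)}` — the `b`-grading of any
integral interpolation of the toric family at the additive split `3` has EXACTLY the `3`-adic size `3^{c·b}`, `c = v₃(N)`, of the
supercuspidal local `ε`-factor. Conditional on Jacquet's cone fact BY NAME. [cite: Hida1988AIF, §5 Lemma 5.2 (ii)]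
[cite: HaoLoeffler2025, Thm. 3.5 (arXiv:2405.12611)] -/
theorem norm_div_eq_norm_level_of_isToricTwoVarLFunctionUpTo₂ (hJ : jacquet1972_functionalEquation_rankinSelbergHecke_cone)
    (hK : IsImaginaryQuadratic K) {N : ℕ} [NeZero N] (h3N : 3 ∣ N) (W : WeierstrassCurve ℚ)
    (Dt : Literature.NumberTheory.EllipticCurves.ModularForms.ModularParametrizationData W N)
    (hH : SatisfiesHeegnerHypothesis N K)
    {𝔭 : HeightOneSpectrum (𝓞 K)} (h3 : ((3 : ℕ) : 𝓞 K) ∈ 𝔭.asIdeal)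
    {𝔭' : HeightOneSpectrum (𝓞 K)} (h3' : ((3 : ℕ) : 𝓞 K) ∈ 𝔭'.asIdeal) (hne : 𝔭' ≠ 𝔭)
    (ι' : PadicAlgCl 3 ≃+* ℂ) (hι : Summit.BirchSwinnertonDyer.BirchSwinnertonDyer.Theorems.SchneiderFree.BranchInducesPrime 3 ι' 𝔭)
    {κ₁ κ₂ : ZpExtension K 3} {γ₁ γ₂ : absoluteGaloisGroup K} (hpair : ZpExtension.IsTopGeneratorPair κ₁ κ₂ γ₁ γ₂)
    (hur₁ : ∀ v : HeightOneSpectrum (𝓞 K), v ≠ 𝔭 → ∀ 𝔓 ∈ v.primesAbove,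
      𝔓.inertia (absoluteGaloisGroup K) ≤ κ₁.kerSubgroup)
    {ΩK : ℂ} {C X Y : ℂ_[3]} {L₂ : PowerSeries (UnrSeries 3)} (hX : X ≠ 0) (hY : Y ≠ 0)
    (hL : IsToricTwoVarLFunctionUpTo₂ C X Y ι' 𝔭 𝔭' κ₁ κ₂ γ₁ γ₂ Dt.f ΩK L₂) (hL0 : L₂ ≠ 0) :
    ‖Y / X‖ = ‖((N : ℕ) : ℂ_[3])‖ := by
  rw [norm_div_eq_of_isToricTwoVarLFunctionUpTo₂ hJ hK W Dt hH h3 h3' hne ι' hι hpair hur₁ hX hY hL hL0]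
  exact norm_kappaHat_eq_norm_level hK.1 hH h3N ι'

end Summit.BirchSwinnertonDyer.BirchSwinnertonDyer.Theorems.UniversalToricDescentThinComb.SizeRigidity

end
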